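import Literature.NumberTheory.Transcendental.KZCubicalCalculus
import HarnessLib

/-!
# Linear independence of `1/(N−1), Li₁(1/N), …, Li_w(1/N)` — cube-integral form (named fact)

Topic `Literature/NumberTheory/DiophantineApproximation`. For every weight `w` there is a
threshold `N₀(w)` such that for every integer `N ≥ N₀(w)` the `w + 1` real numbers

  `I_i(N) = ∫_{[0,1]^i} dx / (N − x₀ x₁ ⋯ x_{i−1})`   (`0 ≤ i ≤ w`)

are linearly independent over `ℚ`.  Expanding the geometric series and integrating termwise,
`I_0(N) = 1/(N − 1)` and `I_i(N) = ∑_{k ≥ 1} N^{-k} / k^i = Li_i(1/N)` for `i ≥ 1`, so this is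
the theorem of Nikišin (1979, qualitative threshold) and David–Hirata-Kohno–Kawashima (2020,
Thm 2.1 with `m = 1`, `x = 0`, `K = ℚ`: any `N` with `log N > w² (1 + log (5/2)) + w log 3`)
on the values of polylogarithms at `1/N`, stated with an unspecified threshold.

## Status in the tree

* The SERIES form is PROVED:
  `Literature.NumberTheory.DiophantineApproximation.one_polylog_linearIndependent`
  (`PolylogLinearIndependence.lean`; `1, Li₁(1/N), …, Li_w(1/N)` over `ℚ`,
  threshold `log N ≥ (w+1)³`).
* Discharging the present fact (`theorem PolylogRigidityNearZero_holds`) therefore only needs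
  the identification `∫_{[0,1]^i} dx/(N − ∏ x) = Li_i(1/N)` (`i ≥ 1`; in the tree for
  `i = 1, 2`) and `= 1/(N−1)` (`i = 0`: the cube `[0,1]⁰` is a point of volume one) —
  geometric series + Tonelli.
* The statement below is, token for token, the `def PolylogRigidityNearZero` of the route
  work-file `Summits/KontsevichZagierPeriods/…/Cruxes/ReductionRigidity/StrategySketchS1.lean`
  §S (with `cube = Literature.NumberTheory.Transcendental.KZ.cube`), which consumes it through
  `stub_padeBoxKernelGen`; the two constants are definitionally equal.

Deliberately NOT here: the explicit threshold of [DavidHirataKohnoKawashima2020, Thm 2.1],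
algebraic points `α ≠ 1/N`, and the proof (see `PolylogLinearIndependence.lean` and siblings).

## References

* E. M. Nikišin, *On irrationality of the values of the functions F(x,s)*, Mat. Sb. 109(151)
  (1979) 410–417. [Nikishin1979]
* S. David, N. Hirata-Kohno, M. Kawashima, *Can polylogarithms at algebraic points be linearly
  independent?*, Moscow J. Comb. Number Theory 9 (2020) 389–406 = arXiv:1912.03811, Thm 2.1.
  [DavidHirataKohnoKawashima2020]
-/

noncomputable section

open MeasureTheory

namespace Literature.NumberTheory.DiophantineApproximation

open Literature.NumberTheory.Transcendental

/-- **Rigidity near zero, uniformly in the weight** (Nikišin 1979; David–Hirata-Kohno–Kawashima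
2020, Thm 2.1 at `x = 0`, `m = 1`, `K = ℚ`): for every `w` there is `N₀` such that for all
integers `N ≥ N₀` the numbers `∫_{[0,1]^i} dp/(N − p₀⋯p_{i−1})`
(`= 1/(N−1), Li₁(1/N), …, Li_w(1/N)`), `0 ≤ i ≤ w`, are `ℚ`-linearly independent: every
rational relation `∑_{i ≤ w} βᵢ · ∫_{[0,1]^i} dp/(N − ∏ p) = 0` is trivial.  Named fact (a
weakening — unspecified threshold — of the printed theorem; the series form is proved in the
tree as `one_polylog_linearIndependent`, see the module docstring for the discharge route).
[cite: DavidHirataKohnoKawashima2020, Thm 2.1] -/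
def PolylogRigidityNearZero : Prop :=
  ∀ w : ℕ, ∃ N₀ : ℕ, ∀ N : ℕ, N₀ ≤ N →
    ∀ β : ℕ → ℚ,
      (∑ i ∈ Finset.range (w + 1), (β i : ℝ) * ∫ p in KZ.cube i, 1 / ((N : ℝ) - ∏ l, p l)) = 0 →
        ∀ i ∈ Finset.range (w + 1), β i = 0

end Literature.NumberTheory.DiophantineApproximation
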